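import Literature.Computability.Complexity.SamplingDeviation
import Mathlib.Data.Fintype.BigOperators
import HarnessLib

/-!
# Selecting the best of `R` random candidates by sampling (counting form)

Trunk `CplxCore`, toolkit. The generic probabilistic step "repeat a randomized construction `R`
times, estimate the quality of each produced hypothesis on `T` fresh uniform test points (with
membership queries to the target), output the empirically best one" — the last step of the NW
reconstruction algorithm of Carmosino–Impagliazzo–Kabanets–Kolokolova (CCC 2016, Thm. 2.11:
"repeat the algorithm `poly(L)` times, and estimate, using random sampling and membership queries
to `f`, the agreement between `f` and each produced circuit `C`. We output the best circuit on our
list") and of every learner that tests candidates — in exact counting form over the randomness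
`Ω = (attempt coins × T test points)^R`, for an ARBITRARY candidate map `cand : Θ → (X → Bool)`
and target `g : X → Bool` on finite types. No machines; everything is proved.

* `agreeFrac h g` — the agreement fraction `#{x | h x = g x} / |X|`;
* `empAgree`, `IsEmpMax` — empirical agreement count of repetition `r` on its own test points,
  and "repetition `r` has a maximal count";
* `card_allBelow_le` — bad event 1 (all `R` attempts produce candidates of agreement `< a`) has
  density `≤ (1 - p)^R` when the attempts of agreement `≥ a` have density `≥ p`;
* `deviantPairs`, `card_deviantPairs_le`, `card_someDeviant_le` — bad event 2 (some empirical
  count deviates from `T · agreeFrac` by `≥ Tη`) has density `≤ R / (4Tη²)` (two-sided weak law,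
  `Literature.Computability.Complexity.card_deviation_le`, and a union bound);
* `card_badSelection_le` — both together; `agreeFrac_of_isEmpMax` — outside the bad events EVERY
  empirical maximizer has agreement `> a - 2η`; `card_exists_badMax_le` — packaged form.

## References

* M. Carmosino, R. Impagliazzo, V. Kabanets, A. Kolokolova, *Learning algorithms from natural
  proofs*, CCC 2016, LIPIcs 50, Thm. 2.11 and the "NW Reconstruction Algorithm" after it
  [CarmosinoImpagliazzoKabanetsKolokolova2016].
* M. J. Kearns, U. V. Vazirani, *An Introduction to Computational Learning Theory*, MIT Press
  1994, §1.2 (testing a hypothesis by sampling) — folklore use.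
-/

namespace Literature.Computability.Complexity

open Finset

/-! ### Agreement, empirical agreement, maximizers -/

section Defs

variable {Θ X : Type*} [Fintype X]

/-- The agreement fraction of two Boolean functions on a finite type: `#{x | h x = g x} / |X|`.
[folklore] -/
noncomputable def agreeFrac (h g : X → Bool) : ℝ :=
  ((univ.filter fun x => h x = g x).card : ℝ) / Fintype.card X

/-- `0 ≤ agreeFrac`. [folklore] -/
theorem agreeFrac_nonneg (h g : X → Bool) : 0 ≤ agreeFrac h g := by
  unfold agreeFrac; positivity

/-- `agreeFrac ≤ 1`. [folklore] -/
theorem agreeFrac_le_one (h g : X → Bool) : agreeFrac h g ≤ 1 := by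
  unfold agreeFrac
  rcases Nat.eq_zero_or_pos (Fintype.card X) with h0 | hpos
  · simp [h0]
  · rw [div_le_one (by exact_mod_cast hpos)]
    exact_mod_cast (card_filter_le _ _).trans (card_univ (α := X)).le

variable (cand : Θ → X → Bool) (g : X → Bool) {R T : ℕ}

/-- The empirical agreement count of repetition `r`: the number of its own `T` test points on
which its candidate agrees with the target (computed with membership queries).
[cite: CarmosinoImpagliazzoKabanetsKolokolova2016, Thm. 2.11] -/
noncomputable def empAgree (ω : Fin R → Θ × (Fin T → X)) (r : Fin R) : ℕ :=
  (univ.filter fun t => cand (ω r).1 ((ω r).2 t) = g ((ω r).2 t)).card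

/-- Repetition `r` has a maximal empirical agreement count ("output the best circuit on our
list"). [cite: CarmosinoImpagliazzoKabanetsKolokolova2016, Thm. 2.11] -/
def IsEmpMax (ω : Fin R → Θ × (Fin T → X)) (r : Fin R) : Prop :=
  ∀ r', empAgree cand g ω r' ≤ empAgree cand g ω r

omit [Fintype X] in
/-- A maximizer exists as soon as `R > 0`. [folklore] -/
theorem exists_isEmpMax (hR : 0 < R) (ω : Fin R → Θ × (Fin T → X)) :
    ∃ r, IsEmpMax cand g ω r := by
  obtain ⟨r, -, hr⟩ := exists_max_image (univ : Finset (Fin R)) (empAgree cand g ω)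
    ⟨⟨0, hR⟩, mem_univ _⟩
  exact ⟨r, fun r' => hr r' (mem_univ r')⟩

end Defs

/-! ### The two bad events and their sizes -/

section Analysis

open scoped Classical

variable {Θ X : Type*} [Fintype Θ] [Fintype X] [Nonempty X]
variable (cand : Θ → X → Bool) (g : X → Bool) {R T : ℕ}

/-- Attempts whose candidate has agreement `< a`. [folklore] -/
noncomputable def belowAttempts (a : ℝ) : Finset Θ :=
  univ.filter fun θ => agreeFrac (cand θ) g < a

/-- **Bad event 1** (all `R` attempts below level `a`) has at most `(1-p)^R |Ω|` elements when
the attempts below level `a` number at most `(1-p)|Θ|`. [folklore] -/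
theorem card_allBelow_le {a p : ℝ} (hp : p ≤ 1)
    (hbad : ((belowAttempts cand g a).card : ℝ) ≤ (1 - p) * Fintype.card Θ) :
    ((univ.filter fun ω : Fin R → Θ × (Fin T → X) =>
        ∀ r, (ω r).1 ∈ belowAttempts cand g a).card : ℝ) ≤
      (1 - p) ^ R * Fintype.card (Fin R → Θ × (Fin T → X)) := by
  classical
  have hset : (univ.filter fun ω : Fin R → Θ × (Fin T → X) =>
      ∀ r, (ω r).1 ∈ belowAttempts cand g a) =
      Fintype.piFinset fun _ : Fin R =>
        belowAttempts cand g a ×ˢ (univ : Finset (Fin T → X)) := by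
    ext ω
    simp only [mem_filter, mem_univ, true_and, Fintype.mem_piFinset, mem_product, and_true]
  rw [hset, Fintype.card_piFinset, prod_const, card_univ, Fintype.card_fin, card_product,
    card_univ, Fintype.card_pi_const (Θ × (Fin T → X)) R, Fintype.card_prod]
  push_cast
  rw [← mul_pow]
  have h1p : (0 : ℝ) ≤ 1 - p := by linarith
  apply pow_le_pow_left₀ (by positivity)
  have hY : (0 : ℝ) ≤ Fintype.card (Fin T → X) := Nat.cast_nonneg _
  calc ((belowAttempts cand g a).card : ℝ) * Fintype.card (Fin T → X)
      ≤ ((1 - p) * Fintype.card Θ) * Fintype.card (Fin T → X) :=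
        mul_le_mul_of_nonneg_right hbad hY
    _ = (1 - p) * (Fintype.card Θ * Fintype.card (Fin T → X)) := by ring

/-- Attempt/sample pairs whose empirical count deviates by `≥ T η` from its mean
`T · agreeFrac`. [folklore] -/
noncomputable def deviantPairs (η : ℝ) (T : ℕ) : Finset (Θ × (Fin T → X)) :=
  univ.filter fun p => (T : ℝ) * η ≤
    |((univ.filter fun t => cand p.1 (p.2 t) = g (p.2 t)).card : ℝ) -
      T * agreeFrac (cand p.1) g|

/-- The deviant pairs are few: `≤ |Θ| |Y| / (4Tη²)` (the two-sided weak law of large numbers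
`Literature.Computability.Complexity.card_deviation_le`, per attempt). [folklore] -/
theorem card_deviantPairs_le {η : ℝ} (hη : 0 < η) (hT : 0 < T) :
    ((deviantPairs cand g η T).card : ℝ) ≤
      Fintype.card (Θ × (Fin T → X)) / (4 * T * η ^ 2) := by
  classical
  have h1 : ((deviantPairs cand g η T).card : ℝ) =
      ∑ θ : Θ, ((univ.filter fun y : Fin T → X => (T : ℝ) * η ≤
        |((univ.filter fun t => cand θ (y t) = g (y t)).card : ℝ) -
          T * agreeFrac (cand θ) g|).card : ℝ) := by
    unfold deviantPairs
    rw [natCast_card_filter, Fintype.sum_prod_type]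
    exact Finset.sum_congr rfl fun q _ => by rw [natCast_card_filter]
  rw [h1, Fintype.card_prod, Nat.cast_mul]
  calc (∑ θ : Θ, ((univ.filter fun y : Fin T → X => (T : ℝ) * η ≤
        |((univ.filter fun t => cand θ (y t) = g (y t)).card : ℝ) -
          T * agreeFrac (cand θ) g|).card : ℝ))
      ≤ ∑ _θ : Θ, (Fintype.card (Fin T → X) : ℝ) / (4 * T * η ^ 2) := by
        refine Finset.sum_le_sum fun θ _ => ?_
        simp only [agreeFrac]
        convert Literature.Computability.Complexity.card_deviation_le (fun x : X => cand θ x = g x) hT hη using 3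
    _ = _ := by rw [Finset.sum_const, card_univ, nsmul_eq_mul]; ring

/-- Counting tuples by one coordinate: `#{ω : ω r ∈ S} = |S| · |Γ|^(R-1)`. [folklore] -/
theorem card_filter_coord_mem_eq {Γ : Type*} [Fintype Γ] [DecidableEq Γ] (S : Finset Γ)
    (r : Fin R) :
    (univ.filter fun ω : Fin R → Γ => ω r ∈ S).card = S.card * Fintype.card Γ ^ (R - 1) := by
  have hfw := Finset.card_eq_sum_card_fiberwise (s := univ.filter fun ω : Fin R → Γ => ω r ∈ S)
    (t := S) (f := fun ω => ω r) fun ω hω => (mem_filter.1 hω).2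
  rw [hfw]
  have : ∀ d ∈ S, ((univ.filter fun ω : Fin R → Γ => ω r ∈ S).filter
      fun ω => ω r = d).card = Fintype.card Γ ^ (R - 1) := by
    intro d hd
    have h := Fintype.card_filter_piFinset_const (ι := Fin R) (univ : Finset Γ) r d
    rw [Fintype.piFinset_univ, if_pos (mem_univ d), card_univ, Fintype.card_fin] at h
    rw [← h]
    congr 1; ext ω
    simp only [mem_filter, mem_univ, true_and]
    exact ⟨fun h => h.2, fun h => ⟨h ▸ hd, h⟩⟩
  rw [Finset.sum_congr rfl this, sum_const, smul_eq_mul]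

/-- **Bad event 2** (some repetition's estimate deviates by `≥ Tη`) has at most
`R |Ω| / (4Tη²)` elements (union bound over the repetitions). [folklore] -/
theorem card_someDeviant_le {η : ℝ} (hη : 0 < η) (hT : 0 < T) :
    ((univ.filter fun ω : Fin R → Θ × (Fin T → X) =>
        ∃ r, ω r ∈ deviantPairs cand g η T).card : ℝ) ≤
      R * (Fintype.card (Fin R → Θ × (Fin T → X)) / (4 * T * η ^ 2)) := by
  classical
  set Γ := Θ × (Fin T → X)
  have hsub : (univ.filter fun ω : Fin R → Γ => ∃ r, ω r ∈ deviantPairs cand g η T) ⊆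
      (univ : Finset (Fin R)).biUnion fun r => univ.filter fun ω : Fin R → Γ =>
        ω r ∈ deviantPairs cand g η T := by
    intro ω hω
    obtain ⟨r, hr⟩ := (mem_filter.1 hω).2
    exact mem_biUnion.2 ⟨r, mem_univ r, mem_filter.2 ⟨mem_univ ω, hr⟩⟩
  rcases Nat.eq_zero_or_pos R with rfl | hR
  · have : (univ.filter fun ω : Fin 0 → Γ => ∃ r, ω r ∈ deviantPairs cand g η T) = ∅ := by
      ext ω; simp
    rw [this]; simp
  calc ((univ.filter fun ω : Fin R → Γ => ∃ r, ω r ∈ deviantPairs cand g η T).card : ℝ)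
      ≤ ((univ : Finset (Fin R)).biUnion fun r => univ.filter fun ω : Fin R → Γ =>
          ω r ∈ deviantPairs cand g η T).card := by exact_mod_cast card_le_card hsub
    _ ≤ ∑ r : Fin R, ((univ.filter fun ω : Fin R → Γ =>
          ω r ∈ deviantPairs cand g η T).card : ℝ) := by exact_mod_cast card_biUnion_le
    _ = ∑ _r : Fin R, ((deviantPairs cand g η T).card : ℝ) * Fintype.card Γ ^ (R - 1) := by
        refine Finset.sum_congr rfl fun r _ => ?_
        have hc := card_filter_coord_mem_eq (R := R) (deviantPairs cand g η T) r
        rw [show (univ.filter fun ω : Fin R → Γ => ω r ∈ deviantPairs cand g η T).card =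
            (deviantPairs cand g η T).card * Fintype.card Γ ^ (R - 1) by convert hc]
        push_cast; ring
    _ ≤ ∑ _r : Fin R, (Fintype.card Γ / (4 * T * η ^ 2)) * (Fintype.card Γ : ℝ) ^ (R - 1) := by
        refine Finset.sum_le_sum fun r _ => ?_
        exact mul_le_mul_of_nonneg_right (card_deviantPairs_le cand g hη hT) (by positivity)
    _ = R * (Fintype.card (Fin R → Γ) / (4 * T * η ^ 2)) := by
        rw [Finset.sum_const, card_univ, Fintype.card_fin, nsmul_eq_mul, Fintype.card_pi_const,
          Nat.cast_pow]
        obtain ⟨R', rfl⟩ := Nat.exists_eq_succ_of_ne_zero hR.ne'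
        simp only [Nat.succ_sub_one, Nat.succ_eq_add_one]
        ring

/-- **Selection by sampling fails rarely.** Randomness: `R` attempts and `R` tuples of `T` test
points. If the attempts producing a candidate of agreement `≥ a` with the target have density
`≥ p` (`p ≤ 1`), then outside a set of randomness of density `≤ (1-p)^R + R/(4Tη²)` neither
are all attempts below level `a` nor does any empirical count deviate by `≥ Tη` — so that
(`agreeFrac_of_isEmpMax`) every empirical maximizer has agreement `> a - 2η`.
[cite: CarmosinoImpagliazzoKabanetsKolokolova2016, Thm. 2.11] -/
theorem card_badSelection_le {a p η : ℝ} (hp : p ≤ 1) (hη : 0 < η) (hT : 0 < T)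
    (hbad : ((belowAttempts cand g a).card : ℝ) ≤ (1 - p) * Fintype.card Θ) :
    ((univ.filter fun ω : Fin R → Θ × (Fin T → X) =>
        (∀ r, (ω r).1 ∈ belowAttempts cand g a) ∨ ∃ r, ω r ∈ deviantPairs cand g η T).card : ℝ) ≤
      ((1 - p) ^ R + R * (1 / (4 * T * η ^ 2))) *
        Fintype.card (Fin R → Θ × (Fin T → X)) := by
  rw [Finset.filter_or, add_mul]
  have h2 : ((univ.filter fun ω : Fin R → Θ × (Fin T → X) =>
      ∃ r, ω r ∈ deviantPairs cand g η T).card : ℝ) ≤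
      R * (1 / (4 * T * η ^ 2)) * Fintype.card (Fin R → Θ × (Fin T → X)) := by
    have h := card_someDeviant_le cand g (R := R) hη hT
    calc _ ≤ _ := h
      _ = _ := by ring
  calc _ ≤ (((univ.filter fun ω : Fin R → Θ × (Fin T → X) =>
          ∀ r, (ω r).1 ∈ belowAttempts cand g a).card : ℕ) : ℝ) +
        ((univ.filter fun ω : Fin R → Θ × (Fin T → X) =>
          ∃ r, ω r ∈ deviantPairs cand g η T).card : ℕ) := by
        exact_mod_cast card_union_le _ _
    _ ≤ _ := add_le_add (card_allBelow_le cand g hp hbad) h2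

omit [Nonempty X] in
/-- **On the good event every empirical maximizer is good**: if some attempt reaches agreement
`≥ a` and no empirical count deviates by `≥ Tη`, then every repetition with a maximal empirical
count has agreement `> a - 2η`. [folklore] -/
theorem agreeFrac_of_isEmpMax {a η : ℝ} (hT : 0 < T)
    (ω : Fin R → Θ × (Fin T → X))
    (h1 : ¬ ∀ r, (ω r).1 ∈ belowAttempts cand g a) (h2 : ¬ ∃ r, ω r ∈ deviantPairs cand g η T)
    {r : Fin R} (hr : IsEmpMax cand g ω r) :
    a - 2 * η < agreeFrac (cand (ω r).1) g := by
  push Not at h1 h2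
  obtain ⟨r₀, hr₀⟩ := h1
  have hgood : a ≤ agreeFrac (cand (ω r₀).1) g := by
    simpa [belowAttempts] using hr₀
  have hdev : ∀ r', |(empAgree cand g ω r' : ℝ) - T * agreeFrac (cand (ω r').1) g| <
      T * η := by
    intro r'
    have := h2 r'
    simp only [deviantPairs, mem_filter, mem_univ, true_and, not_le] at this
    exact this
  have hmax : (empAgree cand g ω r₀ : ℝ) ≤ empAgree cand g ω r := by exact_mod_cast hr r₀
  have hT' : (0 : ℝ) < T := Nat.cast_pos.2 hT
  have a1 := abs_lt.1 (hdev r)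
  have a0 := abs_lt.1 (hdev r₀)
  by_contra hcon
  push Not at hcon
  nlinarith [a1.1, a1.2, a0.1, a0.2]

/-- **Packaged form.** Under the hypotheses of `card_badSelection_le`, the randomness strings for
which SOME empirical maximizer has agreement `≤ a - 2η` number at most
`((1-p)^R + R/(4Tη²)) |Ω|`. [folklore] -/
theorem card_exists_badMax_le {a p η : ℝ} (hp : p ≤ 1) (hη : 0 < η) (hT : 0 < T)
    (hbad : ((belowAttempts cand g a).card : ℝ) ≤ (1 - p) * Fintype.card Θ) :
    ((univ.filter fun ω : Fin R → Θ × (Fin T → X) =>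
        ∃ r, IsEmpMax cand g ω r ∧ agreeFrac (cand (ω r).1) g ≤ a - 2 * η).card : ℝ) ≤
      ((1 - p) ^ R + R * (1 / (4 * T * η ^ 2))) *
        Fintype.card (Fin R → Θ × (Fin T → X)) := by
  refine le_trans ?_ (card_badSelection_le cand g (R := R) hp hη hT hbad)
  have hsub : (univ.filter fun ω : Fin R → Θ × (Fin T → X) =>
        ∃ r, IsEmpMax cand g ω r ∧ agreeFrac (cand (ω r).1) g ≤ a - 2 * η) ⊆
      (univ.filter fun ω : Fin R → Θ × (Fin T → X) =>
        (∀ r, (ω r).1 ∈ belowAttempts cand g a) ∨ ∃ r, ω r ∈ deviantPairs cand g η T) := by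
    intro ω hω
    rw [mem_filter] at hω ⊢
    refine ⟨hω.1, ?_⟩
    by_contra hno
    rw [not_or] at hno
    obtain ⟨r, hr, hle⟩ := hω.2
    exact absurd (agreeFrac_of_isEmpMax cand g hT ω hno.1 hno.2 hr) (not_lt.2 hle)
  exact_mod_cast card_le_card hsub

end Analysis

end Literature.Computability.Complexity
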